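import Summits.FinalStateConjecture.FinalStateConjecture.Theses.PhaseMixingCapture

/-!
# `CaptureSuffices` (crux `stmt-FinalStateConjecture-9953`, route `PhaseMixingCapture`, rank 6):
# the capture hypotheses are only as strong as their most adversarial witnesses

Negative-side support file of the crux disprover (cdisprove seat). The crux is the typed conditional
`NearExtremalKappaCapture → BulkKerrCapture → WeakCosmicCensorshipMGHD → FinalStateConjecture`.
Everything below is proved (`sorry`-free, no new definitions, no named facts).

* §0 `not_captureSuffices_iff` — a disproof of the crux is EXACTLY a proof of both capture
  statements, a proof of weak cosmic censorship (MGHD form) and a disproof of the summit statement.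
* §1–§2 monotonicity of the weighted Sobolev data distance `H^s_δ × H^{s-1}_{δ+1}` in `(s, δ)`
  (`dataWeightedSobolevEDist_mono_indices`) and `0 < χ ≤ 1` for the sub-extremality factor
  `χ = 1 − (a/M)²`.
* §3 **Adversarial witnesses** (`nearExtremalKappaCapture_iff_sharp`, `bulkKerrCapture_iff_sharp`,
  `captureSuffices_iff_sharp`). Both capture items quantify their exponent packages EXISTENTIALLY
  (`∃ (s δ k γ p a₁)`, resp. `∀ a₁ < 1, ∃ (s δ k)`), and their witness sets are monotone: larger
  `(s, δ)` (stronger norm, smaller basin, larger modulus), larger `γ` (smaller near-extremal basin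
  `c·χ^γ`), larger `p` (weaker modulus `C·χ^{-p}`), larger `a₁` (thinner spin range), smaller `k`
  (`ConvergesTo.of_le`) all preserve truth. Hence for EVERY threshold package `(s₀, δ₀, γ₀, p₀, a₀)`
  each capture statement is EQUIVALENT to its sharp form with `s ≥ s₀`, `δ ≥ δ₀`, `γ ≥ γ₀`,
  `p ≥ p₀`, `a₁ ≥ a₀` and `k = 0`, and the crux is EQUIVALENT to the implication from the sharp
  forms. Consequences for a prover of the crux (it consumes the capture statements as hypotheses,
  i.e. must work for every witness): (i) it receives only `C⁰` convergence to Kerr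
  (`ConvergesToKerr … 0`) while the summit demands a `C²` decomposition
  (`FinalStateDecomposition … 2`); (ii) it receives basins only in `H^s_δ` topologies with `δ` as
  large as an adversary likes — for `δ ≥ 0` these basins pin the `1/r` tail of the metric, see the
  companion file `SchwarzschildMassPinning.lean` (two Schwarzschild data sets of different mass are
  at infinite distance), so no Cauchy slice of a development that has radiated a macroscopic amount
  of energy is ever inside a basin; (iii) it receives the near-extremal basin exponent `γ` only
  beyond any bound, so "polynomial closeness to Kerr relative to `κ`" is not available to it: along
  windows parking at extremality it needs closeness faster than EVERY power of `χ`, and along windows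
  bounded away from extremality `BulkKerrCapture` alone already applies. The typed crux therefore
  does not express the route's mechanism (ii of its rationale); the planner-level repair is to FIX
  the packages `(s, δ, k = 2, γ, p)` as explicit route constants shared by items 10606/10696/9953
  (with `δ` in the file's convention small enough that `δM/r` tails have finite norm, i.e.
  `δ < -1/2`), or to state 9953 over universally quantified packages in a declared window.
* The companion file `CounterexampleShape.lean` records `CaptureSuffices ↔ (capture → (WCC ↔ FSC))`
  and the shape of every counterexample (an admissible censored datum with a non-settling MGHD).
-/

-- the problem namespace `FinalStateConjecture.FinalStateConjecture` (single-conjunct summit) trips dupNamespace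
set_option linter.dupNamespace false

noncomputable section

open scoped Manifold ContDiff Topology ENNReal
open Set Filter MeasureTheory

namespace Summit.FinalStateConjecture.FinalStateConjecture.Theorems.CaptureSuffices.Negative

open Literature.Geometry.Lorentzian
open Summit.FinalStateConjecture.FinalStateConjecture.Theses.PhaseMixingCapture
  (NearExtremalKappaCapture BulkKerrCapture WeakCosmicCensorshipMGHD CaptureSuffices)

/-! ## §0 Pure logic: the shape of a disproof -/

/-- A disproof of the crux is exactly: both capture statements, weak cosmic censorship (MGHD
form) AND a disproof of the summit statement. -/
theorem not_captureSuffices_iff :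
    ¬ CaptureSuffices ↔
      NearExtremalKappaCapture ∧ BulkKerrCapture ∧ WeakCosmicCensorshipMGHD ∧
        ¬ FinalStateConjecture := by
  unfold CaptureSuffices
  tauto

/-! ## §1 Monotonicity of the weighted Sobolev distance in its indices -/

section Mono

variable {F G : Type*} [NormedAddCommGroup F] [NormedSpace ℝ F] [NormedAddCommGroup G]
  [NormedSpace ℝ G] [MeasureSpace F]

/-- The weighted Sobolev seminorm `H^s_δ` is monotone in `(s, δ)` (larger `s`: more derivative
terms; larger `δ`: heavier weights `(1 + ‖x‖)^{2(δ+m)} ≥ (1 + ‖x‖)^{2(δ'+m)}` … since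
`1 + ‖x‖ ≥ 1`). -/
theorem weightedSobolevSeminorm_mono_indices (U : Set F) {s s' : ℕ} {δ δ' : ℝ} (hs : s ≤ s')
    (hδ : δ ≤ δ') (f : F → G) :
    weightedSobolevSeminorm U s δ f ≤ weightedSobolevSeminorm U s' δ' f := by
  unfold weightedSobolevSeminorm
  refine ENNReal.rpow_le_rpow ?_ (by norm_num)
  calc ∑ m ∈ Finset.range (s + 1),
        ∫⁻ x in U, ENNReal.ofReal ((1 + ‖x‖) ^ (2 * (δ + m) : ℝ) * ‖iteratedFDeriv ℝ m f x‖ ^ 2)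
      ≤ ∑ m ∈ Finset.range (s + 1),
        ∫⁻ x in U, ENNReal.ofReal ((1 + ‖x‖) ^ (2 * (δ' + m) : ℝ) * ‖iteratedFDeriv ℝ m f x‖ ^ 2) := by
        refine Finset.sum_le_sum fun m _ ↦ lintegral_mono fun x ↦ ENNReal.ofReal_le_ofReal ?_
        refine mul_le_mul_of_nonneg_right ?_ (sq_nonneg _)
        refine Real.rpow_le_rpow_of_exponent_le (by have := norm_nonneg x; linarith) ?_
        linarith
    _ ≤ ∑ m ∈ Finset.range (s' + 1),
        ∫⁻ x in U, ENNReal.ofReal ((1 + ‖x‖) ^ (2 * (δ' + m) : ℝ) * ‖iteratedFDeriv ℝ m f x‖ ^ 2) :=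
        Finset.sum_le_sum_of_subset (Finset.range_subset_range.2 (by omega))

end Mono

/-- The data distance `H^s_δ × H^{s-1}_{δ+1}` is monotone in `(s, δ)`. -/
theorem dataWeightedSobolevEDist_mono_indices {U : TopologicalSpace.Opens E3} {s s' : ℕ}
    {δ δ' : ℝ} (hs : s ≤ s') (hδ : δ ≤ δ') (D₁ D₂ : InitialDataSet 𝓘(ℝ, E3) U) :
    InitialDataSet.dataWeightedSobolevEDist s δ D₁ D₂ ≤
      InitialDataSet.dataWeightedSobolevEDist s' δ' D₁ D₂ := by
  unfold InitialDataSet.dataWeightedSobolevEDist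
  exact add_le_add (weightedSobolevSeminorm_mono_indices _ hs hδ _)
    (weightedSobolevSeminorm_mono_indices _ (Nat.sub_le_sub_right hs 1) (by linarith) _)

/-! ## §2 The sub-extremality factor `χ = 1 − (a/M)²` lies in `(0, 1]` -/

/-- For sub-extremal `(M, a)` with `M > 0`, `χ = 1 − (a/M)² > 0`. -/
theorem chi_pos {M a : ℝ} (hM : 0 < M) (h : Kerr.IsSubextremal M a) : 0 < 1 - (a / M) ^ 2 := by
  have h1 : |a / M| < 1 := by
    rw [abs_div, abs_of_pos hM, div_lt_one hM]
    exact h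
  have h2 : (a / M) ^ 2 < 1 := by
    have := sq_lt_one_iff_abs_lt_one (a / M)
    exact this.2 h1
  linarith

/-- `χ = 1 − (a/M)² ≤ 1`. -/
theorem chi_le_one {M a : ℝ} : 1 - (a / M) ^ 2 ≤ 1 := by
  linarith [sq_nonneg (a / M)]


/-! ## §3 The capture hypotheses in SHARP (adversarial-witness) form

`NearExtremalKappaCapture` and `BulkKerrCapture` are existential in their exponent packages
`(s, δ, k, γ, p, a₁)` resp. `(s, δ, k)`. As HYPOTHESES of `CaptureSuffices` they are therefore
worth exactly their weakest admissible witnesses. The sharp forms (right-hand sides below, no new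
definitions) fix `k = 0` (only `C⁰` convergence to Kerr), add `0 ≤ C`, and push every other
exponent beyond an arbitrary threshold: Sobolev indices `s ≥ s₀`, `δ ≥ δ₀`, near-extremal basin
exponent `γ ≥ γ₀`, modulus exponent `p ≥ p₀`, spin threshold `a₁ ≥ a₀`; otherwise verbatim the
route decls. -/

/-- **Sharpening the near-extremal capture hypothesis costs nothing.** For every threshold
package (with `a₀ < 1`), `NearExtremalKappaCapture` is EQUIVALENT to its adversarial-witness
form. -/
theorem nearExtremalKappaCapture_iff_sharp (s₀ : ℕ) (δ₀ γ₀ p₀ a₀ : ℝ) (ha₀ : a₀ < 1) :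
    NearExtremalKappaCapture ↔
      ∀ [Kerr.Facts] [Kerr.SliceFacts], ∃ (s : ℕ) (δ γ p a₁ : ℝ),
        (s₀ ≤ s ∧ δ₀ ≤ δ ∧ γ₀ ≤ γ ∧ p₀ ≤ p ∧ a₀ ≤ a₁) ∧ a₁ < 1 ∧
        ∀ (M : ℝ) (hM : 0 < M), ∃ c > (0 : ℝ), ∃ C ≥ (0 : ℝ), ∀ a : ℝ, a₁ * M ≤ |a| →
          Kerr.IsSubextremal M a →
          ∀ (D : InitialDataSet 𝓘(ℝ, E3) (Kerr.slice a M)) [D.metric.HasLeviCivita],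
            D.IsVacuumConstraintSolution →
            InitialDataSet.dataWeightedSobolevEDist s δ D (Kerr.data M a M hM.le) <
              ENNReal.ofReal (c * (1 - (a / M) ^ 2) ^ γ) →
            ∀ 𝒟 : VacuumCauchyDevelopment D, 𝒟.IsMaximal →
              ∃ (M' a' : ℝ) (𝒟oc : Set 𝒟.carrier), Kerr.IsSubextremal M' a' ∧
                (∀ [𝒟.metric.HasLeviCivita], ∃ B₀ : Set (Kerr.slice a M), IsCompact B₀ ∧
                  ∀ σ : ℝ, 0 < σ → ∃ B₁ : Set (Kerr.slice a M), IsCompact B₁ ∧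
                    ∀ q ∈ {q : Kerr.slice a M | Kerr.afRadius a M + 1 ≤ ‖(q : E3)‖}, q ∉ B₁ →
                      ∀ (ray : ℝ → 𝒟.carrier) (dom : Set ℝ),
                        𝒟.metric.IsNormalisedNullRayFrom 𝒟.timeOrientation 𝒟.embed 𝒟.normal q ray
                          dom →
                        ¬ BddAbove dom ∨ ENNReal.ofReal σ ≤ sojournTime ray dom
                          (𝒟.metric.causalFuture 𝒟.timeOrientation (𝒟.embed '' B₀))) ∧
                𝒟.toSpacetime.ConvergesToKerr 𝒟oc M' a' 0 ∧
                |M' - M| + |a' - a| ≤ C * (1 - (a / M) ^ 2) ^ (-p) *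
                  √(InitialDataSet.dataWeightedSobolevEDist s δ D (Kerr.data M a M hM.le)).toReal := by
  constructor
  · intro h hF hSF
    obtain ⟨s, δ, k, γ, p, a₁, ha₁, H⟩ := @h hF hSF
    refine ⟨max s s₀, max δ δ₀, max γ γ₀, max p p₀, max a₁ a₀,
      ⟨le_max_right _ _, le_max_right _ _, le_max_right _ _, le_max_right _ _, le_max_right _ _⟩,
      max_lt ha₁ ha₀, ?_⟩
    intro M hM
    obtain ⟨c, hc, C, HC⟩ := H M hM
    refine ⟨c, hc, max C 0, le_max_right _ _, ?_⟩
    intro a ha hsub D inst hvac hdist 𝒟 hmax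
    have hχ0 : 0 < 1 - (a / M) ^ 2 := chi_pos hM hsub
    have hχ1 : 1 - (a / M) ^ 2 ≤ 1 := chi_le_one
    have ha' : a₁ * M ≤ |a| :=
      le_trans (mul_le_mul_of_nonneg_right (le_max_left _ _) hM.le) ha
    have hmono := dataWeightedSobolevEDist_mono_indices (le_max_left s s₀) (le_max_left δ δ₀)
      D (Kerr.data M a M hM.le)
    have hdist' : InitialDataSet.dataWeightedSobolevEDist s δ D (Kerr.data M a M hM.le) <
        ENNReal.ofReal (c * (1 - (a / M) ^ 2) ^ γ) := by
      refine lt_of_le_of_lt hmono (lt_of_lt_of_le hdist (ENNReal.ofReal_le_ofReal ?_))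
      exact mul_le_mul_of_nonneg_left
        (Real.rpow_le_rpow_of_exponent_ge hχ0 hχ1 (le_max_left γ γ₀)) hc.le
    obtain ⟨M', a', 𝒟oc, hsub', hfar, hconv, hmod⟩ := HC a ha' hsub D hvac hdist' 𝒟 hmax
    refine ⟨M', a', 𝒟oc, hsub', hfar, Spacetime.ConvergesTo.of_le hconv (Nat.zero_le k), ?_⟩
    have hfin : InitialDataSet.dataWeightedSobolevEDist (max s s₀) (max δ δ₀) D
        (Kerr.data M a M hM.le) ≠ ⊤ := ne_top_of_lt hdist
    have h1 : (1 - (a / M) ^ 2) ^ (-p) ≤ (1 - (a / M) ^ 2) ^ (-max p p₀) :=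
      Real.rpow_le_rpow_of_exponent_ge hχ0 hχ1 (neg_le_neg (le_max_left p p₀))
    have h2 : √(InitialDataSet.dataWeightedSobolevEDist s δ D (Kerr.data M a M hM.le)).toReal ≤
        √(InitialDataSet.dataWeightedSobolevEDist (max s s₀) (max δ δ₀) D
          (Kerr.data M a M hM.le)).toReal :=
      Real.sqrt_le_sqrt (ENNReal.toReal_mono hfin hmono)
    have h3 : 0 ≤ (1 - (a / M) ^ 2) ^ (-p) := Real.rpow_nonneg hχ0.le _
    calc |M' - M| + |a' - a|
        ≤ C * (1 - (a / M) ^ 2) ^ (-p) *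
            √(InitialDataSet.dataWeightedSobolevEDist s δ D (Kerr.data M a M hM.le)).toReal := hmod
      _ ≤ max C 0 * (1 - (a / M) ^ 2) ^ (-p) *
            √(InitialDataSet.dataWeightedSobolevEDist s δ D (Kerr.data M a M hM.le)).toReal := by
          have : 0 ≤ (1 - (a / M) ^ 2) ^ (-p) *
              √(InitialDataSet.dataWeightedSobolevEDist s δ D (Kerr.data M a M hM.le)).toReal :=
            mul_nonneg h3 (Real.sqrt_nonneg _)
          nlinarith [le_max_left C 0]
      _ ≤ max C 0 * (1 - (a / M) ^ 2) ^ (-max p p₀) *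
            √(InitialDataSet.dataWeightedSobolevEDist (max s s₀) (max δ δ₀) D
              (Kerr.data M a M hM.le)).toReal := by
          have hC : 0 ≤ max C 0 := le_max_right _ _
          exact mul_le_mul (mul_le_mul_of_nonneg_left h1 hC) h2 (Real.sqrt_nonneg _)
            (mul_nonneg hC (h3.trans h1))
  · intro h hF hSF
    obtain ⟨s, δ, γ, p, a₁, -, ha₁, H⟩ := @h hF hSF
    refine ⟨s, δ, 0, γ, p, a₁, ha₁, ?_⟩
    intro M hM
    obtain ⟨c, hc, C, -, HC⟩ := H M hM
    exact ⟨c, hc, C, HC⟩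

/-- **Sharpening the bulk capture hypothesis costs nothing.** -/
theorem bulkKerrCapture_iff_sharp (s₀ : ℕ) (δ₀ : ℝ) :
    BulkKerrCapture ↔
      ∀ [Kerr.Facts] [Kerr.SliceFacts], ∀ a₁ : ℝ, a₁ < 1 → ∃ (s : ℕ) (δ : ℝ), (s₀ ≤ s ∧ δ₀ ≤ δ) ∧
        ∀ (M : ℝ) (hM : 0 < M), ∃ ε > (0 : ℝ), ∃ C ≥ (0 : ℝ), ∀ a : ℝ, |a| ≤ a₁ * M →
          ∀ (D : InitialDataSet 𝓘(ℝ, E3) (Kerr.slice a M)) [D.metric.HasLeviCivita],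
            D.IsVacuumConstraintSolution →
            InitialDataSet.dataWeightedSobolevEDist s δ D (Kerr.data M a M hM.le) <
              ENNReal.ofReal ε →
            ∀ 𝒟 : VacuumCauchyDevelopment D, 𝒟.IsMaximal →
              ∃ (M' a' : ℝ) (𝒟oc : Set 𝒟.carrier), Kerr.IsSubextremal M' a' ∧
                (∀ [𝒟.metric.HasLeviCivita], ∃ B₀ : Set (Kerr.slice a M), IsCompact B₀ ∧
                  ∀ σ : ℝ, 0 < σ → ∃ B₁ : Set (Kerr.slice a M), IsCompact B₁ ∧
                    ∀ q ∈ {q : Kerr.slice a M | Kerr.afRadius a M + 1 ≤ ‖(q : E3)‖}, q ∉ B₁ →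
                      ∀ (ray : ℝ → 𝒟.carrier) (dom : Set ℝ),
                        𝒟.metric.IsNormalisedNullRayFrom 𝒟.timeOrientation 𝒟.embed 𝒟.normal q ray
                          dom →
                        ¬ BddAbove dom ∨ ENNReal.ofReal σ ≤ sojournTime ray dom
                          (𝒟.metric.causalFuture 𝒟.timeOrientation (𝒟.embed '' B₀))) ∧
                𝒟.toSpacetime.ConvergesToKerr 𝒟oc M' a' 0 ∧
                |M' - M| + |a' - a| ≤
                  C * √(InitialDataSet.dataWeightedSobolevEDist s δ D (Kerr.data M a M hM.le)).toReal := by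
  constructor
  · intro h hF hSF a₁ ha₁
    obtain ⟨s, δ, k, H⟩ := @h hF hSF a₁ ha₁
    refine ⟨max s s₀, max δ δ₀, ⟨le_max_right _ _, le_max_right _ _⟩, ?_⟩
    intro M hM
    obtain ⟨ε, hε, C, HC⟩ := H M hM
    refine ⟨ε, hε, max C 0, le_max_right _ _, ?_⟩
    intro a ha D inst hvac hdist 𝒟 hmax
    have hmono := dataWeightedSobolevEDist_mono_indices (le_max_left s s₀) (le_max_left δ δ₀)
      D (Kerr.data M a M hM.le)
    have hdist' : InitialDataSet.dataWeightedSobolevEDist s δ D (Kerr.data M a M hM.le) <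
        ENNReal.ofReal ε := lt_of_le_of_lt hmono hdist
    obtain ⟨M', a', 𝒟oc, hsub', hfar, hconv, hmod⟩ := HC a ha D hvac hdist' 𝒟 hmax
    refine ⟨M', a', 𝒟oc, hsub', hfar, Spacetime.ConvergesTo.of_le hconv (Nat.zero_le k), ?_⟩
    have hfin : InitialDataSet.dataWeightedSobolevEDist (max s s₀) (max δ δ₀) D
        (Kerr.data M a M hM.le) ≠ ⊤ := ne_top_of_lt hdist
    have h2 : √(InitialDataSet.dataWeightedSobolevEDist s δ D (Kerr.data M a M hM.le)).toReal ≤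
        √(InitialDataSet.dataWeightedSobolevEDist (max s s₀) (max δ δ₀) D
          (Kerr.data M a M hM.le)).toReal :=
      Real.sqrt_le_sqrt (ENNReal.toReal_mono hfin hmono)
    calc |M' - M| + |a' - a|
        ≤ C * √(InitialDataSet.dataWeightedSobolevEDist s δ D (Kerr.data M a M hM.le)).toReal :=
          hmod
      _ ≤ max C 0 * √(InitialDataSet.dataWeightedSobolevEDist s δ D (Kerr.data M a M hM.le)).toReal := by
          nlinarith [le_max_left C 0, Real.sqrt_nonneg
            (InitialDataSet.dataWeightedSobolevEDist s δ D (Kerr.data M a M hM.le)).toReal]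
      _ ≤ max C 0 * √(InitialDataSet.dataWeightedSobolevEDist (max s s₀) (max δ δ₀) D
            (Kerr.data M a M hM.le)).toReal :=
          mul_le_mul_of_nonneg_left h2 (le_max_right _ _)
  · intro h hF hSF a₁ ha₁
    obtain ⟨s, δ, -, H⟩ := @h hF hSF a₁ ha₁
    refine ⟨s, δ, 0, ?_⟩
    intro M hM
    obtain ⟨ε, hε, C, -, HC⟩ := H M hM
    exact ⟨ε, hε, C, HC⟩

/-- **The crux with adversarial capture hypotheses is the same crux.** For every threshold
package, `CaptureSuffices` is equivalent to the implication whose capture hypotheses give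
only `C⁰` convergence to Kerr, in Sobolev topologies `H^s_δ` with `s ≥ s₀`, `δ ≥ δ₀`, with
near-extremal basin exponent `γ ≥ γ₀`, modulus exponent `p ≥ p₀` and spin threshold
`a₁ ≥ a₀`. -/
theorem captureSuffices_iff_sharp (s₀ : ℕ) (δ₀ γ₀ p₀ a₀ : ℝ) (ha₀ : a₀ < 1) :
    CaptureSuffices ↔
      ((∀ [Kerr.Facts] [Kerr.SliceFacts], ∃ (s : ℕ) (δ γ p a₁ : ℝ),
          (s₀ ≤ s ∧ δ₀ ≤ δ ∧ γ₀ ≤ γ ∧ p₀ ≤ p ∧ a₀ ≤ a₁) ∧ a₁ < 1 ∧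
          ∀ (M : ℝ) (hM : 0 < M), ∃ c > (0 : ℝ), ∃ C ≥ (0 : ℝ), ∀ a : ℝ, a₁ * M ≤ |a| →
            Kerr.IsSubextremal M a →
            ∀ (D : InitialDataSet 𝓘(ℝ, E3) (Kerr.slice a M)) [D.metric.HasLeviCivita],
              D.IsVacuumConstraintSolution →
              InitialDataSet.dataWeightedSobolevEDist s δ D (Kerr.data M a M hM.le) <
                ENNReal.ofReal (c * (1 - (a / M) ^ 2) ^ γ) →
              ∀ 𝒟 : VacuumCauchyDevelopment D, 𝒟.IsMaximal →
                ∃ (M' a' : ℝ) (𝒟oc : Set 𝒟.carrier), Kerr.IsSubextremal M' a' ∧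
                  (∀ [𝒟.metric.HasLeviCivita], ∃ B₀ : Set (Kerr.slice a M), IsCompact B₀ ∧
                    ∀ σ : ℝ, 0 < σ → ∃ B₁ : Set (Kerr.slice a M), IsCompact B₁ ∧
                      ∀ q ∈ {q : Kerr.slice a M | Kerr.afRadius a M + 1 ≤ ‖(q : E3)‖}, q ∉ B₁ →
                        ∀ (ray : ℝ → 𝒟.carrier) (dom : Set ℝ),
                          𝒟.metric.IsNormalisedNullRayFrom 𝒟.timeOrientation 𝒟.embed 𝒟.normal q ray
                            dom →
                          ¬ BddAbove dom ∨ ENNReal.ofReal σ ≤ sojournTime ray dom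
                            (𝒟.metric.causalFuture 𝒟.timeOrientation (𝒟.embed '' B₀))) ∧
                  𝒟.toSpacetime.ConvergesToKerr 𝒟oc M' a' 0 ∧
                  |M' - M| + |a' - a| ≤ C * (1 - (a / M) ^ 2) ^ (-p) *
                    √(InitialDataSet.dataWeightedSobolevEDist s δ D (Kerr.data M a M hM.le)).toReal) →
      (∀ [Kerr.Facts] [Kerr.SliceFacts], ∀ a₁ : ℝ, a₁ < 1 → ∃ (s : ℕ) (δ : ℝ), (s₀ ≤ s ∧ δ₀ ≤ δ) ∧
          ∀ (M : ℝ) (hM : 0 < M), ∃ ε > (0 : ℝ), ∃ C ≥ (0 : ℝ), ∀ a : ℝ, |a| ≤ a₁ * M →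
            ∀ (D : InitialDataSet 𝓘(ℝ, E3) (Kerr.slice a M)) [D.metric.HasLeviCivita],
              D.IsVacuumConstraintSolution →
              InitialDataSet.dataWeightedSobolevEDist s δ D (Kerr.data M a M hM.le) <
                ENNReal.ofReal ε →
              ∀ 𝒟 : VacuumCauchyDevelopment D, 𝒟.IsMaximal →
                ∃ (M' a' : ℝ) (𝒟oc : Set 𝒟.carrier), Kerr.IsSubextremal M' a' ∧
                  (∀ [𝒟.metric.HasLeviCivita], ∃ B₀ : Set (Kerr.slice a M), IsCompact B₀ ∧
                    ∀ σ : ℝ, 0 < σ → ∃ B₁ : Set (Kerr.slice a M), IsCompact B₁ ∧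
                      ∀ q ∈ {q : Kerr.slice a M | Kerr.afRadius a M + 1 ≤ ‖(q : E3)‖}, q ∉ B₁ →
                        ∀ (ray : ℝ → 𝒟.carrier) (dom : Set ℝ),
                          𝒟.metric.IsNormalisedNullRayFrom 𝒟.timeOrientation 𝒟.embed 𝒟.normal q ray
                            dom →
                          ¬ BddAbove dom ∨ ENNReal.ofReal σ ≤ sojournTime ray dom
                            (𝒟.metric.causalFuture 𝒟.timeOrientation (𝒟.embed '' B₀))) ∧
                  𝒟.toSpacetime.ConvergesToKerr 𝒟oc M' a' 0 ∧
                  |M' - M| + |a' - a| ≤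
                    C * √(InitialDataSet.dataWeightedSobolevEDist s δ D (Kerr.data M a M hM.le)).toReal) →
        WeakCosmicCensorshipMGHD → FinalStateConjecture) := by
  unfold CaptureSuffices
  rw [nearExtremalKappaCapture_iff_sharp s₀ δ₀ γ₀ p₀ a₀ ha₀, bulkKerrCapture_iff_sharp s₀ δ₀]


end Summit.FinalStateConjecture.FinalStateConjecture.Theorems.CaptureSuffices.Negative
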